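/-
Copyright (c) 2026 the pub-hodgecm-mathlib formalisation cell (harness21).  Prover seat hodgecm-mathlib-R90-IF-p01 (g2), programme R90-TF, section S9 «InnerForm-13.3.6 (c)»,
deal (tw-s) «`sock_S9_smoothTwist_cm` payer census → `Theorems/R90S9SmoothTwistOfLevelTest.lean` if ≤ 80 l.» (R90-IF-plan (g2), R90 bus 2026-09-04T23:20:21Z ∕ 23:32:49Z).
-/
import Summits.HodgeConjecture.HodgeConjecture.Theorems.R90S9TransferPairExistsOfKitLaws   -- ★ p862997 (R90-IF-p02 (g2)): `smooth_tensOfPair_of_kitLaw` (pin (iv) «if» half ⟹ `Smooth (tensOfPair p)` on `𝓕₀`); cone ★ `Smooth_cm` (p862941)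
import Summits.HodgeConjecture.HodgeConjecture.Theorems.R90S9Sec146LevelPins               -- ★ p862607 (R90-IF-p04 (g2)): `isLevelTest_twistTest` (PIN `h𝓕tw`: the level test class is closed under the Hecke twist); cone ★ Levels
import HarnessLib

/-!
# R90-TF · S9 «InnerForm-13.3.6 (c)» — `Smooth_cm` IS CLOSED UNDER THE HECKE TWIST `f′ ↦ f′ ∗ h` ON THE LEVEL TEST CLASS (the sub-socket `sock_S9_smoothTwist_cm` of FILE B ED. 4, PAID)
# (Rogawski 1990 §14.6 p. 242 l. 10–22; §13.7 p. 206; §14.2 p. 233)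

Cell `hodgecm-mathlib`, crux H413 (`stmt-HodgeConjecture-24833`, lane `--supports … --as helper`), route of record `HCCMUnconditional` (count-neutral).  Programme R90-TF (brief
`director/R90-BRIEF.v2.md` 1f40d54518340a35), section S9 = InnerForm-13.3.6 (c) (base `R90-IF`); seat R90-IF-p01 (g2).  Theorems only (no `def`, no instance, no notation, no
named-fact hypothesis, no `sorry`); imports ★ `Theorems` only.

WHAT THIS FILE IS.  R90-IF-typ2 (g2)'s ASSEMBLY v2 of FILE B ED. 4 (`Cruxes/H413/Lines/R90_S9_InnerFormTransportB.lean`) types the Hecke-twist laws `hTw ∕ hTHw` as two ∃-sockets in the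
(MN-cm) SHAPE (Smooth-free) plus ONE sub-socket
  `sock_S9_smoothTwist_cm : ∀ ‹prefix› l h f′, IsLevelTest l f′ → Smooth_cm f′ → Smooth_cm (twistTest l h f′)`
from which the head derives (δ6b)'s `Smooth`-conjunct shapes in one line each.  THIS FILE PAYS that sub-socket, generically in the kit's `Smooth` predicate, modulo the kit law
`hsm` «a test pure tensor is `Smooth`» (pin (iv) of `IsPinned`, «if» half; B: `(IsPinned.smooth_iff hpin f′).2` — the SAME hypothesis as ★ p862997's `hex` payer, no new letter):
`Smooth_cm p := 𝓕₀ p ∧ Smooth (tensOfPair p)` (★ p862941, TG-4); the level test class is closed under the twist (★ `isLevelTest_twistTest`, PIN `h𝓕tw`: at a place of the declared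
support `f_v ⋆ F_v` is bi-`K_v`-invariant, hence locally constant, and compactly supported; the non-unit set grows by at most `F.T`), `IsLevelTest l ⊆ 𝓕₀` (drop the level clause),
and a `𝓕₀`-pair realises as a TEST pure tensor, hence is `Smooth` (★ `smooth_tensOfPair_of_kitLaw hsm`).  The hypothesis `Smooth_cm f′` of the socket is carried (binder
`_hs`, positionally as typed) but not needed: `IsLevelTest l f′` alone suffices.  ≈ 10 proof lines.  Axioms `propext`, `Classical.choice`, `Quot.sound`.
HONEST LABEL: HC_CM is proved only modulo the 7 printed citations (2 remaining named inputs: hLiu418 = stmt-HodgeConjecture-24832, h413 = stmt-HodgeConjecture-24833) until rung 0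
closes.  Bookkeeping on test functions; pays nothing printed; one B ED. 4 sub-socket becomes ★ by name (count re-read only when B is BUILT).

## References
* [Rogawski1990] J. D. Rogawski, *Automorphic Representations of Unitary Groups in Three Variables*, Ann. of Math. Stud. 123 (1990), §14.6 p. 242 l. 10–22; §13.7 p. 206; §14.2 p. 233.
* [CartierCorvallis1979] P. Cartier, *Representations of p-adic groups: a survey*, Proc. Sympos. Pure Math. 33.1 (1979), §IV.1.
* [BorelJacquet1979] A. Borel, H. Jacquet, *Automorphic forms and automorphic representations*, Proc. Sympos. Pure Math. 33.1 (1979), §4.1.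
-/

set_option autoImplicit false
set_option linter.dupNamespace false  -- the mandated namespace repeats the summit's segment (`HodgeConjecture.HodgeConjecture`)

noncomputable section

open NumberField IsDedekindDomain MeasureTheory
open scoped Matrix
open Literature.NumberTheory Literature.NumberTheory.Automorphic Literature.NumberTheory.Automorphic.UnitaryGroup
open Literature.NumberTheory.Rogawski1990
open Summit.HodgeConjecture.HodgeConjecture.Cruxes.H413
open Summit.HodgeConjecture.HodgeConjecture.Cruxes.H413.F0P3InnerFormClassificationV6 (TestGp)

namespace Summit.HodgeConjecture.HodgeConjecture.R90.S9

/-- **`Smooth_cm` IS CLOSED UNDER THE HECKE TWIST ON THE LEVEL TEST CLASS** — FILE B ED. 4's sub-socket `sock_S9_smoothTwist_cm` PAID modulo the kit law `hsm` (pin (iv), «if» half):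
for a local-measure family `μ_v` (left invariant), a level `l`, an unramified Hecke tensor `h` off `l` and a level test pair `f′ = (φ, (f_v)_v)`, `Smooth_cm (twistTest l h f′)`.
Proof: ★ `isLevelTest_twistTest` gives `IsLevelTest l (f′ ∗ h)`, whose clauses minus the level clause are `𝓕₀ (f′ ∗ h)`; ★ `smooth_tensOfPair_of_kitLaw hsm` gives `Smooth (tensOfPair (f′ ∗ h))`.
The binder `_hs : Smooth_cm f′` is the socket's, carried unused. [cite: Rogawski1990, §14.6 p. 242 l. 10–22; §13.7 p. 206; §14.2 p. 233] [cite: CartierCorvallis1979, §IV.1] -/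
theorem smooth_cm_twistTest
    (L : Type) [Field L] [NumberField L] [IsCMField L] (ι : L →+* ℂ) (H : Matrix (Fin 3) (Fin 3) L) (T : GL (Fin 3) ℂ)
    (hT : (T : Matrix (Fin 3) (Fin 3) ℂ)ᴴ * H.map ι * (T : Matrix (Fin 3) (Fin 3) ℂ) = Literature.Geometry.ComplexHyperbolic.BallModel.J)
    -- the kit's smoothness predicate on `C_c(G′(𝔸))` (B: `𝔨.Smooth`) and its pin (iv) «if» half (B: `fun f′ h => (IsPinned.smooth_iff hpin f′).2 h`)
    (Smooth : TestGp L H → Prop)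
    (hsm : ∀ f' : TestGp L H, (∃ T' : PureTensor L 3 H, T'.IsTest ∧ ⇑f' = T'.eval) → Smooth f')
    -- local measures on the `U(H)(L⁺_v)` (Borel), left invariant (B: `νG`, Haar)
    (μv : ∀ v : HeightOneSpectrum (𝓞 ↥(maximalRealSubfield L)), @Measure ((cmDatum L 3 H).Local v) (borel _))
    (hμ : ∀ v, letI : MeasurableSpace ((cmDatum L 3 H).Local v) := borel _; (μv v).IsMulLeftInvariant)
    (l : InnerFormSec146.Level L) (h : InnerFormSec146.HeckeOff L H l)
    (f' : (UnitaryGroup.arch (↥(maximalRealSubfield L)) L (IsCMField.complexConj L) 3 H → ℂ) ×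
      (∀ v : HeightOneSpectrum (𝓞 ↥(maximalRealSubfield L)), (cmDatum L 3 H).Local v → ℂ))
    (hl : InnerFormSec146.IsLevelTest L ι H T hT l f') (_hs : Smooth_cm L ι H T hT Smooth f') :
    Smooth_cm L ι H T hT Smooth (InnerFormSec146.twistTest L H μv l h f') := by
  -- the level test class is closed under the twist (PIN `h𝓕tw`, ★ p04)
  obtain ⟨harch, hloc, -, hfin⟩ := InnerFormSec146.isLevelTest_twistTest L ι H T hT μv hμ l h f' hl
  -- `𝓕₀ (f′ ∗ h)` = the level-test clauses minus the level clause; the realised pure tensor is `Smooth` by the kit law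
  exact ⟨⟨harch, hloc, hfin⟩, smooth_tensOfPair_of_kitLaw L ι H T hT Smooth hsm _ ⟨harch, hloc, hfin⟩⟩

end Summit.HodgeConjecture.HodgeConjecture.R90.S9

end
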